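import Summits.QuantumFields.YangMills.Theorems.AllWindowsColdBoxBoxHighLineBoxToChartReduction
import Summits.QuantumFields.YangMills.Theorems.AllWindowsColdBoxBoxHighLineLandauRepresentativeStrong
import Summits.QuantumFields.YangMills.Theorems.AllWindowsColdBoxBoxHighLineOrbitJacobianFinalSup

/-!
# Step A at the U5 window: the FP representation and the box → FP-chart reduction in the window `C·H⁸·(1+log β)⁵ ≤ β` of ✓T-S5.4J∞,
# with the STRONG Landau representative ✓U2 (`s·H³(1+log H) ≤ c₀`) and precision `β^{−p}`

Width seat `ym-line-sfw-p2-w2` (prover-ym-line-sfw-p2-w2-g32-0).  The downstream re-packaging of ✓`OrbitJacobian.orbitNormaliserJacobian_sup` for the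
next rung U5 (LINE-20 ⟨stmt-QuantumFields-24336⟩, `stub_landauThirdOrder`, window `θ ≤ θL < 1/10`; U5 prep, helper — U5 is UNSTAFFED, I23 open;
planner ym-idea-2 g18, `Cruxes/BoxWindowHighSU2213/U5-BLOCKERS.md` lifts L1 + «U2 in Step A»).  These are ✓`fpRepresentation_window` (fcl-p3) and w2 g31's
✓`BoxToChart.boxPlaqCov_sub_chartCov_le_window'` re-run with

* the Landau representative (i) from ✓U2 `stub_landauRepresentativeStrong : LandauRepresentativeBound` (premise `spl·H³(1+log H) ≤ c₀`, radius
  `r₀ = K·H·(1+log H)·spl`, `K = √C_{U2}`) instead of S4b (`spl·H⁴(1+log H)² ≤ c₀`, `r₀ = K·H(1+log H)²spl`);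
* the orbit-normaliser precision (ii) from ✓T-S5.4J∞ `orbitNormaliserJacobian_sup p`: window `C·H⁸(1+log β)⁵ ≤ β`, `δ = β^{−p}`, radius gap
  `r₀ + 2H²(1+log β)²/√β ≤ r`, cut-off condition `C·r·H² ≤ 1`.

* ★★ `fpRepresentation_window_sup (p)` — `|E_box[F] − E_box[F·h_J·1_SP]/E_box[h_J·1_SP]| ≤ 4β^{−p} + 4·P_box(¬SP)` for gauge-invariant measurable
  `0 ≤ F ≤ 1`;
* ★★ `BoxToChart.boxPlaqCov_sub_chartCov_le_window_sup (p)` — Steps A+B+C: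
  `|boxPlaqCov β H T − (⟨c₀c_T⟩_D − ⟨c₀⟩_D⟨c_T⟩_D)| ≤ 200·(β^{−p} + P_box(¬SP) + τ)` with the T-S5.6(′) conclusion `hτ` as input.

Everything proved; no definitions; tree only; standard axioms.  HONEST LABEL: plumbing (U5 prep, helper) — the exponent bookkeeping of Steps A–C at the
U5 window (the analogue of ✓`BoxToChart.exists_exponents` / ✓`…_relative`) and the lifts L2–L5 are NOT here; S5 is untouched; U5, ⟨24336⟩, ⟨24004⟩
remain OPEN; no stub is closed by name; no crux, rung or summit is proved; **the Yang–Mills mass gap is NOT proved by this file; no summit is proved by a line.**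
-/

set_option autoImplicit false

noncomputable section

open MeasureTheory
open Literature.Probability.LatticeModels (Site)
open Literature.MathematicalPhysics.QuantumFieldTheory.AxialGauge (boxEdges)
open Literature.MathematicalPhysics.QuantumLattice (LGConfig gaugeTransformZd fundamentalRep)
open Summit.QuantumFields.YangMills.Theorems.WeakCouplingRates (boxState boxCentre boxPlaqCov)

namespace Summit.QuantumFields.YangMills.Theorems.AllWindowsColdBoxBoxHighLine

/-- ★★ **T-S5.5J at the U5 window**: for `r₀ := K·H·(1+log H)·spl` (`K = √C_{U2}`), `δ := β^{−p} ≤ 1/2`, in the window `C·H⁸(1+log β)⁵ ≤ β`,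
`C r₀ H² ≤ 1`, `r₀ + 2H²(1+log β)²/√β ≤ r`, `C r H² ≤ 1`, and the U2 premise `spl·H³(1+log H) ≤ c₀`: for every gauge-invariant measurable
`0 ≤ F ≤ 1`, `|E_box[F] − E_box[F h_J 1_SP]/E_box[h_J 1_SP]| ≤ 4β^{−p} + 4·P_box(¬SP)`.
From ✓`fpRepresentation`, ✓`OrbitJacobian.orbitNormaliserJacobian_sup` and ✓U2 `stub_landauRepresentativeStrong`. [folklore] -/
theorem fpRepresentation_window_sup (p : ℕ) :
    ∃ K C c₀ : ℝ, 0 < K ∧ 0 < C ∧ 0 < c₀ ∧ ∀ H : ℕ, 1 ≤ H → ∀ β spl r : ℝ, 2 ≤ β →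
      C * (H : ℝ) ^ 8 * (1 + Real.log β) ^ 5 ≤ β → (β ^ p)⁻¹ ≤ 1 / 2 →
      0 ≤ spl → spl * (H : ℝ) ^ 3 * (1 + Real.log H) ≤ c₀ →
      C * (K * H * (1 + Real.log H) * spl) * (H : ℝ) ^ 2 ≤ 1 →
      K * H * (1 + Real.log H) * spl + 2 * ((H : ℝ) ^ 2 * (1 + Real.log β) ^ 2 / Real.sqrt β) ≤ r → C * r * (H : ℝ) ^ 2 ≤ 1 →
      ∀ F : LGConfig 4 SU2 → ℝ, (∀ g : InteriorGauge H, ∀ U, F (gaugeTransformZd (extendGauge H g) U) = F U) →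
        Measurable F → (∀ U, 0 ≤ F U) → (∀ U, F U ≤ 1) →
        |(∫ U, F U ∂(boxState (fundamentalRep (Fin 2)) β H)) -
            (∫ U, F U * (jacWeight β H r U * spIndicator H spl U) ∂(boxState (fundamentalRep (Fin 2)) β H)) /
              (∫ U, jacWeight β H r U * spIndicator H spl U ∂(boxState (fundamentalRep (Fin 2)) β H))| ≤
          4 * (β ^ p)⁻¹ + 4 * ((boxState (fundamentalRep (Fin 2)) β H) {U | ¬ SmallPlaquettes H spl U}).toReal := by
  obtain ⟨C₂, c₀, hC₂, hc₀, h2⟩ := stub_landauRepresentativeStrong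
  obtain ⟨C, hC, hR⟩ := OrbitJacobian.orbitNormaliserJacobian_sup p
  refine ⟨Real.sqrt C₂, C, c₀, Real.sqrt_pos.2 hC₂, hC, hc₀, ?_⟩
  intro H hH β spl r hβ hwin hδ hspl hprem hr₀C hgap hrC F hFinv hFm hF0 hF1
  set r₀ : ℝ := Real.sqrt C₂ * H * (1 + Real.log H) * spl with hr₀
  have hHr : (1 : ℝ) ≤ (H : ℝ) := by exact_mod_cast hH
  have hlogH : 0 ≤ 1 + Real.log (H : ℝ) := by linarith [Real.log_nonneg hHr]
  have hr₀0 : 0 ≤ r₀ := by rw [hr₀]; positivity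
  have hr₀sq : r₀ ^ 2 = C₂ * (H : ℝ) ^ 2 * (1 + Real.log H) ^ 2 * spl ^ 2 := by
    rw [hr₀]
    have := Real.sq_sqrt hC₂.le
    ring_nf
    rw [this]
    ring
  have hβ0 : 0 < β := by linarith
  refine fpRepresentation H β r r₀ spl ((β ^ p)⁻¹) hH hβ0 (by positivity) hδ ?_ ?_ F hFinv hFm hF0 hF1
  · -- (i) the strong Landau representative from U2
    intro U hU hsp
    obtain ⟨g, hg, hL, hlinks⟩ := h2 H hH spl hspl hprem U hU hsp
    exact ⟨g, hg, hL, fun e he => (hlinks e he).trans_eq hr₀sq.symm⟩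
  · -- (ii) the orbit-normaliser precision from T-S5.4J∞
    intro V hV hlinks
    exact hR H hH β r₀ r hβ hwin hr₀0 hr₀C hgap hrC V hV hlinks

namespace BoxToChart

/-- ★★ **T-S5.13A (Steps A+B+C) at the U5 window**, structural inputs by name (U2 ✓`stub_landauRepresentativeStrong`, T-S5.4J∞
✓`OrbitJacobian.orbitNormaliserJacobian_sup`): in the window `C·H⁸(1+log β)⁵ ≤ β`, `β^{−p} ≤ 1/2`, `spl·H³(1+log H) ≤ c₀`, `C r₀ H² ≤ 1`
(`r₀ = K·H(1+log H)·spl`), `r₀ + 2H²(1+log β)²/√β ≤ r`, `C r H² ≤ 1`, plus the small-field parameters `0 ≤ s ≤ 1/100`, `17s² ≤ spl²` and the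
T-S5.6(′) conclusion `hτ`:  `|boxPlaqCov β H T − (⟨c₀c_T⟩_D − ⟨c₀⟩_D⟨c_T⟩_D)| ≤ 200·(β^{−p} + P_box(¬SP) + τ)`. [folklore] -/
theorem boxPlaqCov_sub_chartCov_le_window_sup (p : ℕ) :
    ∃ K C c₀ : ℝ, 0 < K ∧ 0 < C ∧ 0 < c₀ ∧ ∀ H : ℕ, 1 ≤ H → ∀ (β spl r s τ : ℝ) (T : ℕ), 2 ≤ β →
      C * (H : ℝ) ^ 8 * (1 + Real.log β) ^ 5 ≤ β → (β ^ p)⁻¹ ≤ 1 / 2 →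
      0 ≤ spl → spl * (H : ℝ) ^ 3 * (1 + Real.log H) ≤ c₀ →
      C * (K * H * (1 + Real.log H) * spl) * (H : ℝ) ^ 2 ≤ 1 →
      K * H * (1 + Real.log H) * spl + 2 * ((H : ℝ) ^ 2 * (1 + Real.log β) ^ 2 / Real.sqrt β) ≤ r → C * r * (H : ℝ) ^ 2 ≤ 1 →
      0 ≤ s → s ≤ 1 / 100 → 17 * s ^ 2 ≤ spl ^ 2 → 0 ≤ τ →
      (∫ a in chartDomain H \ smallField H s, fpChartWeight β H r a ≤ τ * ∫ a in smallField H (s / 2), fpChartWeight β H r a) →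
      |boxPlaqCov (fundamentalRep (Fin 2)) β H T -
          ((∫ a in smallField H s, chartPlaqCost H (boxCentre H) 1 2 a * chartPlaqCost H (boxCentre H + Pi.single 0 (T : ℤ)) 1 2 a *
                fpChartWeight β H r a) / (∫ a in smallField H s, fpChartWeight β H r a) -
            (∫ a in smallField H s, chartPlaqCost H (boxCentre H) 1 2 a * fpChartWeight β H r a) /
                (∫ a in smallField H s, fpChartWeight β H r a) *
              ((∫ a in smallField H s, chartPlaqCost H (boxCentre H + Pi.single 0 (T : ℤ)) 1 2 a * fpChartWeight β H r a) /
                (∫ a in smallField H s, fpChartWeight β H r a)))| ≤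
        200 * ((β ^ p)⁻¹ + ((boxState (fundamentalRep (Fin 2)) β H) {U | ¬ SmallPlaquettes H spl U}).toReal + τ) := by
  obtain ⟨C₂, c₀, hC₂, hc₀, h2⟩ := stub_landauRepresentativeStrong
  obtain ⟨C, hC, hR⟩ := OrbitJacobian.orbitNormaliserJacobian_sup p
  refine ⟨Real.sqrt C₂, C, c₀, Real.sqrt_pos.2 hC₂, hC, hc₀, ?_⟩
  intro H hH β spl r s τ T hβ hwin hδ hspl hprem hr₀C hgap hrC hs0 hs1 hspls hτ0 hτ
  set r₀ : ℝ := Real.sqrt C₂ * H * (1 + Real.log H) * spl with hr₀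
  have hHr : (1 : ℝ) ≤ (H : ℝ) := by exact_mod_cast hH
  have hlogH : 0 ≤ 1 + Real.log (H : ℝ) := by linarith [Real.log_nonneg hHr]
  have hr₀0 : 0 ≤ r₀ := by rw [hr₀]; positivity
  have hr₀sq : r₀ ^ 2 = C₂ * (H : ℝ) ^ 2 * (1 + Real.log H) ^ 2 * spl ^ 2 := by
    rw [hr₀]
    have := Real.sq_sqrt hC₂.le
    ring_nf
    rw [this]
    ring
  refine boxPlaqCov_sub_chartCov_le H hH (r₀ := r₀) T (by linarith) (by positivity) hδ ?_ ?_ hs0 hs1 hspls hτ0 hτ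
  · -- (i) the strong Landau representative from U2
    intro U hU hsp
    obtain ⟨g, hg, hL, hlinks⟩ := h2 H hH spl hspl hprem U hU hsp
    exact ⟨g, hg, hL, fun e he => (hlinks e he).trans_eq hr₀sq.symm⟩
  · -- (ii) the orbit-normaliser precision from T-S5.4J∞
    intro V hV hlinks
    exact hR H hH β r₀ r hβ hwin hr₀0 hr₀C hgap hrC V hV hlinks

end BoxToChart

end Summit.QuantumFields.YangMills.Theorems.AllWindowsColdBoxBoxHighLine

end
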